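import Summits.BirchSwinnertonDyer.BirchSwinnertonDyer.Theorems.Rank2ObservatoryRank3ConductorCensus3
import Summits.BirchSwinnertonDyer.BirchSwinnertonDyer.Theorems.Rank2ObservatoryRank3ConductorCensus
import HarnessLib

/-!
# BSD rank ≥ 2 observatory (`b2b-bsdr2`): the rank-3 census headline for EVERY row tame at `2`,
# with `hlow`, `hw`, `hmin`, `hN` all discharged

HONEST FRAMING: per-curve certified theorems and census instruments; no claim on BSD in rank ≥ 2.

Packaging leaf (unit `b2b-bsdr2-cert-2`, gen 6).  The conductor hypothesis `hN : conductorNorm ℤ = N`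
of the rank-3 census theorems is discharged by kernel certificates in two disjoint families: the gen-5
certificates `rank3RNCerts` (rows with no additive reduction at `3`; `Rank2ObservatoryRank3ConductorCensus`,
modulo the five named facts on conductor exponents) and the gen-6 certificates with the place `3`
`rank3RN3Certs` (rows additive at `3`; `Rank2ObservatoryRank3ConductorCensus3`, modulo the same five
facts and the Table II fact at `3`), in both cases exactly for the rows TAME AT `2` (`2 ∤ Δ` or `2 ∤ c₄`:
there the exponent at `2` is `0` or `1` by reduction type; the `v(N)` column of the `ℚ₂` table is not
transcribed in the tree).  This file makes that a statement about the TABLE: `Rank3Row.tameAtTwo` is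
read off the integer model; a row tame at `2` either carries a gen-5 certificate (which checks on it by
the gen-5 kernel theorem `rank3Table_rnCheck` with `check_of_rnRowsCheck` (`Rank2ObservatoryRank3MinimalCensus`), hence is tame on it: `RNCert.tame_of_check`) or, by the
gen-6 kernel cover walk `rank3_coverWalk`, is listed in `rank3RN3Certs` (and its certificate checks by
the chunk theorems, hence is tame on it); in both cases the conductor census of that family applies:
`Rank3Row.conductorNorm_eq_of_mem_of_tameAtTwo : r ∈ rank3Table → r.tameAtTwo → (facts) → N_E = N`.
Count (kernel): `6463` of the `9487` rows are tame at `2` (`= 5347 + 1116`); the `3024` rows additive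
at `2` keep `hN` as a hypothesis.  Headline: `Rank3Row.rank3_lderiv_eq_zero_kernel_final`.

References: Silverman *ATAEC* IV.10 [Silverman1994]; Rizzo 2003 [Rizzo2003]; Cremona 1997
[CremonaAlgorithms1997]; Gross 1991 [GrossLMS1991].
-/

set_option linter.dupNamespace false
set_option autoImplicit false

open WeierstrassCurve IsDedekindDomain Literature Literature.NumberTheory.EllipticCurves

namespace Summit.BirchSwinnertonDyer.BirchSwinnertonDyer.Rank2Observatory

open RootNumber

/-- A row is TAME AT `2` if `2 ∤ Δ` or `2 ∤ c₄` of its integer model (good or multiplicative reduction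
at `2`). [cite: SilvermanAEC2009, VII.5 Prop. 5.1] -/
def Rank3Row.tameAtTwo (r : Rank3Row) : Bool :=
  !decide ((2 : ℤ) ∣ r.intModel.Δ) || !decide ((2 : ℤ) ∣ r.intModel.c₄)

/-- A checking gen-5 certificate is tame on an equation tame at `2` (`2 ∤ Δ` forces `k2 = 0`;
`2 ∤ c₄` forces `c₄ ≠ 0` and `k4 = 0`). [folklore] -/
theorem RNCert.tame_of_check {W₀ : WeierstrassCurve ℤ} {c : RNCert} (hc : c.check W₀ = true)
    (ht : ¬ (2 : ℤ) ∣ W₀.Δ ∨ ¬ (2 : ℤ) ∣ W₀.c₄) : c.tame W₀ = true := by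
  obtain ⟨hk2, hk4, -⟩ := RNCert.check_spec hc
  simp only [RNCert.tame, Bool.or_eq_true, Bool.and_eq_true, decide_eq_true_eq]
  rcases ht with h | h
  · left
    by_contra hk
    exact h (dvd_trans (dvd_pow_self 2 hk) (exactPow_spec hk2).1)
  · right
    have hc0 : W₀.c₄ ≠ 0 := fun h0 ↦ h (h0 ▸ dvd_zero 2)
    refine ⟨?_, hc0⟩
    by_contra hk
    exact h (dvd_trans (dvd_pow_self 2 hk) (exactPow_spec (hk4.resolve_left hc0)).1)

/-- A checking gen-6 certificate is tame on an equation tame at `2`. [folklore] -/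
theorem RNCert3.tame_of_check {W₀ : WeierstrassCurve ℤ} {c : RNCert3} (hc : c.check W₀ = true)
    (ht : ¬ (2 : ℤ) ∣ W₀.Δ ∨ ¬ (2 : ℤ) ∣ W₀.c₄) : c.tame W₀ = true := by
  obtain ⟨hk2, hk4, -⟩ := RNCert3.check_spec hc
  simp only [RNCert3.tame, Bool.or_eq_true, Bool.and_eq_true, decide_eq_true_eq]
  rcases ht with h | h
  · left
    by_contra hk
    exact h (dvd_trans (dvd_pow_self 2 hk) (exactPow_spec hk2).1)
  · right
    have hc0 : W₀.c₄ ≠ 0 := fun h0 ↦ h (h0 ▸ dvd_zero 2)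
    refine ⟨?_, hc0⟩
    by_contra hk
    exact h (dvd_trans (dvd_pow_self 2 hk) (exactPow_spec (hk4.resolve_left hc0)).1)

/-- `tameAtTwo` as a proposition. [folklore] -/
theorem Rank3Row.not_dvd_of_tameAtTwo {r : Rank3Row} (ht : r.tameAtTwo = true) :
    ¬ (2 : ℤ) ∣ r.intModel.Δ ∨ ¬ (2 : ℤ) ∣ r.intModel.c₄ := by
  simpa only [Rank3Row.tameAtTwo, Bool.or_eq_true, Bool.not_eq_true', decide_eq_false_iff_not]
    using ht

/-- **`6463` of the `9487` rank-3 census rows are tame at `2`** (kernel count; `= 5347 + 1116`).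
[cite: CremonaAlgorithms1997, Tables] -/
theorem rank3Table_tameAtTwo_count : rank3Table.countP Rank3Row.tameAtTwo = 6463 := by
  decide +kernel

/-- **`N_E = N` for EVERY rank-3 census row tame at `2`**, modulo the five named facts on conductor
exponents and the Table II conductor-exponent fact at `3` (hypotheses by name).
[cite: Silverman1994, IV.10.2 and IV.10.4] [cite: Rizzo2003, Table II (p. 4), column v(N)] -/
theorem Rank3Row.conductorNorm_eq_of_mem_of_tameAtTwo {r : Rank3Row} (hr : r ∈ rank3Table)
    (ht : r.tameAtTwo = true)
    (h0 : ∀ v : HeightOneSpectrum ℤ, conductorExponent_eq_zero_iff v r.curve)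
    (h1 : ∀ v : HeightOneSpectrum ℤ, conductorExponent_eq_one_iff v r.curve)
    (h2 : ∀ v : HeightOneSpectrum ℤ, two_le_conductorExponent_iff v r.curve)
    (h5 : ∀ v : HeightOneSpectrum ℤ, conductorExponent_le_two_of_five_le_natGenerator r.curve v)
    (hf : ∀ v : HeightOneSpectrum ℤ, factorization_conductorNorm r.curve v)
    (h3 : r.curve.conductorExponent_eq_tableConductorExponentThree) :
    r.curve.conductorNorm ℤ = r.N := by
  obtain ⟨i, hi, rfl⟩ := List.getElem_of_mem hr
  have ht' := Rank3Row.not_dvd_of_tameAtTwo ht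
  have hi' : i < rank3RNCerts.length := by
    rw [rank3RNCerts_length]; rw [rank3Table_length] at hi; exact hi
  rcases h : rank3RNCerts[i]'hi' with _ | c
  · -- no gen-5 certificate: the row is listed in the gen-6 list (kernel cover walk)
    have hmem : 0 + i ∈ rank3RN3Certs.map Prod.fst :=
      mem_of_coverWalk _ 0 _ rank3_coverWalk i (by rw [List.getElem?_eq_getElem hi', h])
    rw [Nat.zero_add] at hmem
    obtain ⟨⟨i', c⟩, hm, hii⟩ := List.mem_map.mp hmem
    simp only at hii
    subst hii
    obtain ⟨hi2, hc, -⟩ := check_of_mem_rn3Certs hm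
    exact Rank3Row.conductorNorm_eq_of_certified3
      (Rank3Row.conductorCertified3_of_mem hm hi (RNCert3.tame_of_check hc ht')) h0 h1 h2 h5 hf h3
  · -- a gen-5 certificate, tame on the row
    have hc : rank3RNCerts[i]? = some (some c) := by rw [List.getElem?_eq_getElem hi', h]
    exact Rank3Row.conductorNorm_eq_of_certified
      (Rank3Row.conductorCertified_of_idx hi hc (RNCert.tame_of_check
        (check_of_rnRowsCheck _ _ rank3Table_rnCheck i hi c hc) ht')) h0 h1 h2 h5 hf

/-- **`L′(E,1) = 0` over `K = ℚ(√D)` for EVERY rank-3 census row tame at `2`, with `hlow`, `hw`,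
`hmin` and `hN` ALL DISCHARGED** (kernel certificates; `hw` modulo the two named root-number facts
`hKD`/`hR`, `hN` modulo the five conductor-exponent facts and `h3`): the remaining hypotheses are
modularity `hE`, Gross–Zagier–Kolyvagin over `K` (`hGZKK`), `K` (`hK`, `hdK`) and the twist value
`hLD`. [cite: GrossLMS1991, (1.1) and Thm. 1.3] [cite: Silverman1994, IV.10.2 and IV.10.4] -/
theorem Rank3Row.rank3_lderiv_eq_zero_kernel_final {r : Rank3Row} (hr : r ∈ rank3Table)
    (ht : r.tameAtTwo = true) (K : Type) [Field K] [NumberField K]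
    (hE : WeierstrassCurve.hasEntireLFunction_rat)
    (hGZKK : mordellWeilRank_eq_one_of_LDerivEK_ne_zero r.curve K)
    (h0 : ∀ v : HeightOneSpectrum ℤ, conductorExponent_eq_zero_iff v r.curve)
    (h1 : ∀ v : HeightOneSpectrum ℤ, conductorExponent_eq_one_iff v r.curve)
    (h2 : ∀ v : HeightOneSpectrum ℤ, two_le_conductorExponent_iff v r.curve)
    (h5 : ∀ v : HeightOneSpectrum ℤ, conductorExponent_le_two_of_five_le_natGenerator r.curve v)
    (hf : ∀ v : HeightOneSpectrum ℤ, factorization_conductorNorm r.curve v)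
    (h3 : r.curve.conductorExponent_eq_tableConductorExponentThree)
    (hK : IsImaginaryQuadratic K) (hdK : NumberField.discr K = r.D)
    (hKD : r.curve.rootNumber_eq_neg_finprod_tableLocalRootNumberAt')
    (hR : r.curve.rootNumber_eq_neg_finprod_fullTableLocalRootNumberAt)
    (hLD : (r.curve.quadraticTwist (r.D : ℚ)).entireLFunction 1 ≠ 0) :
    deriv r.curve.entireLFunction 1 = 0 :=
  Rank3Row.rank3_lderiv_eq_zero_kernel_wm hr K hE hGZKK
    (Rank3Row.conductorNorm_eq_of_mem_of_tameAtTwo hr ht h0 h1 h2 h5 hf h3) hK hdK hKD hR hLD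

/-- Self-test (kernel): row `0` (`5077a1`, `Δ` odd) and row `30` (`27747c1`) are tame at `2`.
[cite: CremonaAlgorithms1997, Tables] -/
example : (rank3Table[0]'(by rw [rank3Table_length]; norm_num)).tameAtTwo = true ∧
    (rank3Table[30]'(by rw [rank3Table_length]; norm_num)).tameAtTwo = true := by
  constructor <;> decide +kernel

end Summit.BirchSwinnertonDyer.BirchSwinnertonDyer.Rank2Observatory
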